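import Literature.Computability.Complexity.StackArith
import HarnessLib

/-!
# Verified routines on stack programs: counted loops, emitters, readers, iterated addition

Trunk `CplxCore`, toolkit continuing `StackPrograms.lean` and `StackArith.lean`. To assemble
larger polynomial-time machines from structured stack programs (`Com`, compiled to Mathlib's
`TM2` model by `Com.mem_FP`) one needs, beyond the arithmetic bank `AReg` of `StackArith.lean`, a
supply of *program registers* and generic routines moving data between the two. This file works
over a register type `AReg ⊕ κ` — the bank plus arbitrary program registers `κ` (bank programs
are embedded by `Com.map Sum.inl`, `Runs.inl`) — and provides, each with a functional
specification and an exact step bound (`Com.Runs`):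

* over any register type: `Com.pushN` (push a constant `n` times) and the **counted-loop rule
  with an indexed invariant** `Com.runs_indexLoop` (a `loop` over a register whose contents only
  drive the iteration count: if the body leads from the `i`-th to the `(i+1)`-st invariant state
  for every `i` in range, the loop leads from the `j`-th to the `(j + |v|)`-th state in
  `(C + 2)|v| + 1` steps) — the workhorse for nested loops;
* `Com.repBits k` (every bit repeated `k` times; the doubling of `boolPair` is `repBits 2`) with
  its algebra (`repBits_append`, `repBits_repBits`, `repBits_replicate`, `reverse_repBits`);
* `Com.emitLoop src dst k` (pop a bank register, pushing each bit `k` times on a program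
  register: `dst := repBits k (reverse src) ++ dst`), `Com.fillLoop` (push `k` copies of a fixed
  bit per popped bit), `Com.mulAddLoop c` (`x := x + |c| · y` by the bank's `add`, functional
  model `Com.iterAdd` with value `bitsToNat_iterAdd` and length `length_iterAdd_le`),
  `Com.readLoop h c` (move `|c|` bits from a program register onto the bank's `s`, reversed:
  `s := reverse (take |c| h) ++ s`, `h := drop |c| h`), `Com.truncLoop c` (the same from the
  bank's `x`).

First client: `Cryptography/SISFunctionMachine.lean` (Ajtai's SIS function is polynomial-time).
Relocation note: `Cryptography/SISFunctionProofs.lean` (which predates this file) carries copies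
of `pushN`/`runs_pushN` and `iterAdd`/`bitsToNat_iterAdd`/`length_iterAdd_le` specialised to its
register type (`Literature.SIS.pushN`, `Literature.SIS.iterAdd`, …); they are superseded by the generic
versions here and will be removed when that file is next revised.

## References

* T. Nipkow, G. Klein, *Concrete Semantics with Isabelle/HOL*, Springer 2014, §7.2 (big-step
  rules; the loop rule with an invariant). (Not held; standard, fully proved here.)
* D. E. Knuth, *The Art of Computer Programming*, Vol. 2, 3rd ed., 1998, §4.3.1 (the addition
  routine of `StackArith.lean` iterated here).
-/

namespace Literature.Computability.Complexity

namespace Com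

open AReg

section AnyRegs

variable {ι : Type} [DecidableEq ι]

/-- `pushN k b n`: push the bit `b` on register `k`, `n` times. [folklore] -/
def pushN (k : ι) (b : Bool) : ℕ → Com ι
  | 0 => skip
  | n + 1 => push k b ;; pushN k b n

/-- Effect of `pushN`, in `n` steps. [folklore] -/
theorem runs_pushN (k : ι) (b : Bool) : ∀ (n : ℕ) (R : Regs ι),
    Runs (pushN k b n) R (Function.update R k (List.replicate n b ++ R k)) n
  | 0, R => (Runs.skip R).of_eq (by simp) le_rfl
  | n + 1, R => by
    refine ((Runs.push k b R).seq (runs_pushN k b n _)).of_eq ?_ (by omega)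
    simp [List.replicate_succ']

/-- **Counted loops with an indexed invariant.** If the body, run with any contents `w` of the
loop register `c` on top of the `i`-th invariant state, reaches the `(i+1)`-st invariant state
with the same `w` within `C` steps, then the loop started with `v` in `c` on top of the `j`-th
state reaches the `(j + |v|)`-th state within `(C + 2)|v| + 1` steps. (The invariant states have
`c` empty; the contents of `c` only drive the iteration count.) [Nipkow–Klein 2014, §7.2
(loop rule)] [folklore] -/
theorem runs_indexLoop {c : ι} {body : Com ι} (Φ : ℕ → Regs ι) (C : ℕ)
    (hΦ : ∀ i, Φ i c = []) (v : List Bool) :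
    ∀ j : ℕ, (∀ i, j ≤ i → i < j + v.length → ∀ w : List Bool,
      Runs body (Function.update (Φ i) c w) (Function.update (Φ (i + 1)) c w) C) →
      Runs (loop c body body) (Function.update (Φ j) c v) (Φ (j + v.length))
        ((C + 2) * v.length + 1) := by
  induction v with
  | nil =>
    intro j _
    refine (Runs.loop_nil _ _ (by simp)).of_eq ?_ (by simp)
    rw [Function.update_eq_self_iff.2 (hΦ j).symm]; simp
  | cons b v ih =>
    intro j hbody
    have hk : (Function.update (Φ j) c (b :: v)) c = b :: v := by simp
    have hupd : Function.update (Function.update (Φ j) c (b :: v)) c v = Function.update (Φ j) c v := by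
      simp
    have h1 : Runs body (Function.update (Φ j) c v) (Function.update (Φ (j + 1)) c v) C :=
      hbody j le_rfl (by simp) v
    have h2 := ih (j + 1) fun i hi hi' w => hbody i (by omega) (by simp at hi' ⊢; omega) w
    have e : j + 1 + v.length = j + (b :: v).length := by simp; omega
    rw [e] at h2
    cases b
    · exact (Runs.loop_false' hk hupd h1 h2).of_eq rfl (by simp; ring_nf; omega)
    · exact (Runs.loop_true' hk hupd h1 h2).of_eq rfl (by simp; ring_nf; omega)

end AnyRegs

/-! ### Routines over the arithmetic bank plus program registers `κ` -/

/-- Every bit repeated `k` times. [folklore] -/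
def repBits (k : ℕ) (l : List Bool) : List Bool := l.flatMap fun b => List.replicate k b

/-- `repBits` of the empty string. [folklore] -/
@[simp] theorem repBits_nil (k : ℕ) : repBits k [] = [] := rfl

/-- `repBits` of a cons. [folklore] -/
@[simp] theorem repBits_cons (k : ℕ) (b : Bool) (l : List Bool) :
    repBits k (b :: l) = List.replicate k b ++ repBits k l := rfl

/-- `repBits` is a monoid morphism. [folklore] -/
@[simp] theorem repBits_append (k : ℕ) (l l' : List Bool) :
    repBits k (l ++ l') = repBits k l ++ repBits k l' := by
  simp [repBits, List.flatMap_append]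

/-- Length of `repBits`. [folklore] -/
@[simp] theorem length_repBits (k : ℕ) (l : List Bool) : (repBits k l).length = k * l.length := by
  induction l with
  | nil => simp
  | cons b l ih => simp [ih]; ring

/-- `repBits` of a constant string. [folklore] -/
theorem repBits_replicate (a b : ℕ) (c : Bool) :
    repBits a (List.replicate b c) = List.replicate (b * a) c := by
  induction b with
  | zero => simp
  | succ b ih => rw [List.replicate_succ, repBits_cons, ih, Nat.succ_mul, Nat.add_comm,
      List.replicate_add]

/-- Iterated repetition multiplies the factors. [folklore] -/
theorem repBits_repBits (a b : ℕ) (l : List Bool) : repBits a (repBits b l) = repBits (b * a) l := by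
  induction l with
  | nil => rfl
  | cons c l ih => rw [repBits_cons, repBits_append, ih, repBits_cons, repBits_replicate]

/-- `repBits 1` is the identity. [folklore] -/
@[simp] theorem repBits_one (l : List Bool) : repBits 1 l = l := by
  induction l with
  | nil => rfl
  | cons b l ih => simp [ih]

/-- `repBits` commutes with reversal. [folklore] -/
theorem reverse_repBits (k : ℕ) (l : List Bool) : (repBits k l).reverse = repBits k l.reverse := by
  induction l with
  | nil => rfl
  | cons b l ih => simp [repBits_append, ih]

section BankPlus

variable {κ : Type} [DecidableEq κ]

/-- `emitLoop src dst k`: pop the bank register `src` bit by bit, pushing each bit `k` times on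
the program register `dst`: `dst := repBits k (reverse src) ++ dst`. [folklore] -/
def emitLoop (src : AReg) (dst : κ) (k : ℕ) : Com (AReg ⊕ κ) :=
  loop (Sum.inl src) (pushN (Sum.inr dst) true k) (pushN (Sum.inr dst) false k)

/-- **Simulation of `emitLoop`**, in `(k + 2)|src| + 1` steps. [folklore] -/
theorem runs_emitLoop (src : AReg) (dst : κ) (k : ℕ) (v : List Bool) :
    ∀ (F : Regs AReg) (P : Regs κ), F src = v →
      Runs (emitLoop src dst k) (Sum.elim F P)
        (Sum.elim (Function.update F src []) (Function.update P dst (repBits k v.reverse ++ P dst)))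
        ((k + 2) * v.length + 1) := by
  induction v with
  | nil =>
    intro F P hF
    refine (Runs.loop_nil _ _ (by simpa only [Sum.elim_inl] using hF)).of_eq ?_ (by simp)
    rw [Function.update_eq_self_iff.2 hF.symm]
    simp only [List.reverse_nil, repBits_nil, List.nil_append, Function.update_eq_self]
  | cons b v ih =>
    intro F P hF
    have hk : (Sum.elim F P) (Sum.inl src) = b :: v := by simpa only [Sum.elim_inl] using hF
    have hupd : Function.update (Sum.elim F P) (Sum.inl src) v = Sum.elim (Function.update F src v) P := by
      rw [Sum.update_elim_inl]
    have hbody : ∀ d : Bool, Runs (pushN (Sum.inr dst : AReg ⊕ κ) d k)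
        (Sum.elim (Function.update F src v) P)
        (Sum.elim (Function.update F src v) (Function.update P dst (List.replicate k d ++ P dst))) k := by
      intro d
      refine (runs_pushN _ d k _).of_eq ?_ le_rfl
      rw [Sum.update_elim_inr, Sum.elim_inr]
    have hrest := fun d : Bool => ih (Function.update F src v)
      (Function.update P dst (List.replicate k d ++ P dst)) (Function.update_self ..)
    have e : ∀ d : Bool, Sum.elim (Function.update (Function.update F src v) src [])
        (Function.update (Function.update P dst (List.replicate k d ++ P dst)) dst
          (repBits k v.reverse ++ Function.update P dst (List.replicate k d ++ P dst) dst)) =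
        Sum.elim (Function.update F src []) (Function.update P dst (repBits k (d :: v).reverse ++ P dst)) := by
      intro d
      simp only [Function.update_idem, Function.update_self, List.reverse_cons, repBits_append,
        repBits_cons, repBits_nil, List.append_nil, List.append_assoc]
    cases b
    · exact (Runs.loop_false' hk hupd (hbody false) ((hrest false).congr (e false))).of_eq rfl
        (by simp; ring_nf; omega)
    · exact (Runs.loop_true' hk hupd (hbody true) ((hrest true).congr (e true))).of_eq rfl
        (by simp; ring_nf; omega)

/-- `fillLoop src dst b k`: pop the bank register `src` bit by bit, pushing `k` copies of the
fixed bit `b` on `dst` each time: `dst := b^{k |src|} ++ dst`. [folklore] -/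
def fillLoop (src : AReg) (dst : κ) (b : Bool) (k : ℕ) : Com (AReg ⊕ κ) :=
  loop (Sum.inl src) (pushN (Sum.inr dst) b k) (pushN (Sum.inr dst) b k)

/-- **Simulation of `fillLoop`**, in `(k + 2)|src| + 1` steps. [folklore] -/
theorem runs_fillLoop (src : AReg) (dst : κ) (b : Bool) (k : ℕ) (v : List Bool) :
    ∀ (F : Regs AReg) (P : Regs κ), F src = v →
      Runs (fillLoop src dst b k) (Sum.elim F P)
        (Sum.elim (Function.update F src []) (Function.update P dst (List.replicate (k * v.length) b ++ P dst)))
        ((k + 2) * v.length + 1) := by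
  induction v with
  | nil =>
    intro F P hF
    refine (Runs.loop_nil _ _ (by simpa only [Sum.elim_inl] using hF)).of_eq ?_ (by simp)
    rw [Function.update_eq_self_iff.2 hF.symm]
    simp only [List.length_nil, Nat.mul_zero, List.replicate_zero, List.nil_append, Function.update_eq_self]
  | cons d v ih =>
    intro F P hF
    have hk : (Sum.elim F P) (Sum.inl src) = d :: v := by simpa only [Sum.elim_inl] using hF
    have hupd : Function.update (Sum.elim F P) (Sum.inl src) v = Sum.elim (Function.update F src v) P := by
      rw [Sum.update_elim_inl]
    have hbody : Runs (pushN (Sum.inr dst : AReg ⊕ κ) b k)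
        (Sum.elim (Function.update F src v) P)
        (Sum.elim (Function.update F src v) (Function.update P dst (List.replicate k b ++ P dst))) k := by
      refine (runs_pushN _ b k _).of_eq ?_ le_rfl
      rw [Sum.update_elim_inr, Sum.elim_inr]
    have hrest := ih (Function.update F src v) (Function.update P dst (List.replicate k b ++ P dst))
      (Function.update_self ..)
    have e : Sum.elim (Function.update (Function.update F src v) src [])
        (Function.update (Function.update P dst (List.replicate k b ++ P dst)) dst
          (List.replicate (k * v.length) b ++ Function.update P dst (List.replicate k b ++ P dst) dst)) =
        Sum.elim (Function.update F src []) (Function.update P dst (List.replicate (k * (d :: v).length) b ++ P dst)) := by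
      simp only [Function.update_idem, Function.update_self, List.length_cons, ← List.append_assoc,
        List.replicate_append_replicate, Nat.mul_succ]
    cases d
    · exact (Runs.loop_false' hk hupd hbody (hrest.congr e)).of_eq rfl (by simp; ring_nf; omega)
    · exact (Runs.loop_true' hk hupd hbody (hrest.congr e)).of_eq rfl (by simp; ring_nf; omega)

/-- Iterated addition of a fixed summand (the functional model of `mulAddLoop`). [folklore] -/
def iterAdd (ys : List Bool) : ℕ → List Bool → List Bool
  | 0, xs => xs
  | k + 1, xs => iterAdd ys k (addRes xs ys)

omit [DecidableEq κ] in
/-- Value of the iterated addition. [folklore] -/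
theorem bitsToNat_iterAdd (ys : List Bool) : ∀ (k : ℕ) (xs : List Bool),
    bitsToNat (iterAdd ys k xs) = bitsToNat xs + k * bitsToNat ys
  | 0, xs => by simp [iterAdd]
  | k + 1, xs => by rw [iterAdd, bitsToNat_iterAdd ys k, bitsToNat_addRes]; ring

omit [DecidableEq κ] in
/-- Length of the iterated addition: at most one more bit per step. [folklore] -/
theorem length_iterAdd_le (ys : List Bool) : ∀ (k : ℕ) (xs : List Bool) (m : ℕ),
    xs.length ≤ m → ys.length ≤ m → (iterAdd ys k xs).length ≤ m + k
  | 0, xs, m, h, _ => by simpa [iterAdd] using h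
  | k + 1, xs, m, h, hy => by
    rw [iterAdd]
    have h1 : (addRes xs ys).length ≤ m + 1 := by
      have := length_addRes_le_max xs ys
      have : max xs.length ys.length ≤ m := max_le h hy
      omega
    have := length_iterAdd_le ys k (addRes xs ys) (m + 1) h1 (by omega)
    omega

/-- `mulAddLoop c`: pop the program register `c` bit by bit, adding `y` to `x` each time:
`x := x + |c| · y` (`y` preserved). [folklore] -/
def mulAddLoop (c : κ) : Com (AReg ⊕ κ) := loop (Sum.inr c) (add.map Sum.inl) (add.map Sum.inl)

/-- **Simulation of `mulAddLoop`**: with `|x|, |y| ≤ m` and clean scratch `s t f`, in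
`(26 (m + |c|) + 14)|c| + 1` steps. [folklore] -/
theorem runs_mulAddLoop (c : κ) (v : List Bool) :
    ∀ (xs ys z u g : List Bool) (m : ℕ), xs.length ≤ m → ys.length ≤ m → ∀ (P : Regs κ), P c = v →
      Runs (mulAddLoop c) (Sum.elim (file xs ys z [] [] u [] g) P)
        (Sum.elim (file (iterAdd ys v.length xs) ys z [] [] u [] g) (Function.update P c []))
        ((26 * (m + v.length) + 14) * v.length + 1) := by
  induction v with
  | nil =>
    intro xs ys z u g m hx hy P hP
    refine (Runs.loop_nil _ _ (by simpa only [Sum.elim_inr] using hP)).of_eq ?_ (by simp)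
    rw [Function.update_eq_self_iff.2 hP.symm]; rfl
  | cons b v ih =>
    intro xs ys z u g m hx hy P hP
    have hbody : Runs (add.map Sum.inl : Com (AReg ⊕ κ)) (Sum.elim (file xs ys z [] [] u [] g) (Function.update P c v))
        (Sum.elim (file (addRes xs ys) ys z [] [] u [] g) (Function.update P c v))
        (13 * (xs.length + ys.length) + 12) :=
      (runs_add xs ys z u g).inl _
    have h1 : (addRes xs ys).length ≤ m + 1 := by
      have := length_addRes_le_max xs ys
      have : max xs.length ys.length ≤ m := max_le hx hy
      omega
    have hrest := ih (addRes xs ys) ys z u g (m + 1) h1 (by omega) (Function.update P c v)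
      (Function.update_self ..)
    have hk : (Sum.elim (file xs ys z [] [] u [] g) P) (Sum.inr c) = b :: v := by
      simpa only [Sum.elim_inr] using hP
    have hupd : Function.update (Sum.elim (file xs ys z [] [] u [] g) P) (Sum.inr c) v =
        Sum.elim (file xs ys z [] [] u [] g) (Function.update P c v) := by
      rw [Sum.update_elim_inr]
    have e : Sum.elim (file (iterAdd ys v.length (addRes xs ys)) ys z [] [] u [] g)
        (Function.update (Function.update P c v) c []) =
        Sum.elim (file (iterAdd ys (b :: v).length xs) ys z [] [] u [] g) (Function.update P c []) := by
      simp only [Function.update_idem, List.length_cons, iterAdd]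
    cases b
    · refine (Runs.loop_false' hk hupd hbody (hrest.congr e)).of_eq rfl ?_
      simp only [List.length_cons]; nlinarith [hx, hy]
    · refine (Runs.loop_true' hk hupd hbody (hrest.congr e)).of_eq rfl ?_
      simp only [List.length_cons]; nlinarith [hx, hy]

/-- `readLoop h c`: pop the counter register `c` bit by bit, each time moving the top bit of the
program register `h` onto the bank register `s` (nothing if `h` is empty): `s := reverse (take
|c| h) ++ s`, `h := drop |c| h`. [folklore] -/
def readLoop (h c : κ) : Com (AReg ⊕ κ) :=
  loop (Sum.inr c)
    (pop (Sum.inr h) (push (Sum.inl .s) true) (push (Sum.inl .s) false) skip)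
    (pop (Sum.inr h) (push (Sum.inl .s) true) (push (Sum.inl .s) false) skip)

/-- One guarded move of the top bit of `h` onto `s`. [folklore] -/
theorem runs_readStep {h : κ} (hs : List Bool) (F : Regs AReg) (P : Regs κ) (hh : P h = hs) :
    Runs (pop (Sum.inr h : AReg ⊕ κ) (push (Sum.inl .s) true) (push (Sum.inl .s) false) skip)
      (Sum.elim F P)
      (Sum.elim (Function.update F .s ((hs.take 1).reverse ++ F .s)) (Function.update P h (hs.drop 1))) 3 := by
  cases hs with
  | nil =>
    refine (Runs.pop_nil _ _ (by simpa only [Sum.elim_inr] using hh) (Runs.skip _)).of_eq ?_ (by norm_num)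
    simp only [List.take_nil, List.reverse_nil, List.nil_append, List.drop_nil, Function.update_eq_self]
    rw [Function.update_eq_self_iff.2 hh.symm]
  | cons d hs =>
    have hkh : (Sum.elim F P) (Sum.inr h) = d :: hs := by simpa only [Sum.elim_inr] using hh
    have hup : Function.update (Sum.elim F P) (Sum.inr h) hs = Sum.elim F (Function.update P h hs) := by
      rw [Sum.update_elim_inr]
    cases d
    · refine (Runs.pop_false' _ _ hkh hup (Runs.push' ?_)).of_eq rfl (by norm_num)
      rw [Sum.update_elim_inl]; rfl
    · refine (Runs.pop_true' _ _ hkh hup (Runs.push' ?_)).of_eq rfl (by norm_num)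
      rw [Sum.update_elim_inl]; rfl

/-- **Simulation of `readLoop`**, in `5|c| + 1` steps. [folklore] -/
theorem runs_readLoop {h c : κ} (hhc : h ≠ c) (v : List Bool) :
    ∀ (hs : List Bool) (F : Regs AReg) (P : Regs κ), P c = v → P h = hs →
      Runs (readLoop h c) (Sum.elim F P)
        (Sum.elim (Function.update F .s ((hs.take v.length).reverse ++ F .s))
          (Function.update (Function.update P h (hs.drop v.length)) c []))
        (5 * v.length + 1) := by
  induction v with
  | nil =>
    intro hs F P hc hh
    refine (Runs.loop_nil _ _ (by simpa only [Sum.elim_inr] using hc)).of_eq ?_ (by simp)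
    simp only [List.length_nil, List.take_zero, List.drop_zero, List.reverse_nil, List.nil_append,
      Function.update_eq_self]
    have e1 : Function.update P h hs = P := Function.update_eq_self_iff.2 hh.symm
    rw [e1]
    have e2 : Function.update P c [] = P := Function.update_eq_self_iff.2 hc.symm
    rw [e2]
  | cons b v ih =>
    intro hs F P hc hh
    have hk : (Sum.elim F P) (Sum.inr c) = b :: v := by simpa only [Sum.elim_inr] using hc
    have hupd : Function.update (Sum.elim F P) (Sum.inr c) v = Sum.elim F (Function.update P c v) := by
      rw [Sum.update_elim_inr]
    have hbody := runs_readStep hs F (Function.update P c v)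
      (by rw [Function.update_of_ne hhc, hh])
    have hrest := ih (hs.drop 1) (Function.update F .s ((hs.take 1).reverse ++ F .s))
      (Function.update (Function.update P c v) h (hs.drop 1))
      (by rw [Function.update_of_ne hhc.symm, Function.update_self]) (Function.update_self ..)
    have e : Sum.elim (Function.update (Function.update F .s ((hs.take 1).reverse ++ F .s)) .s
          (((hs.drop 1).take v.length).reverse ++ Function.update F .s ((hs.take 1).reverse ++ F .s) .s))
        (Function.update (Function.update (Function.update (Function.update P c v) h (hs.drop 1)) h
          ((hs.drop 1).drop v.length)) c []) =
        Sum.elim (Function.update F .s ((hs.take (b :: v).length).reverse ++ F .s))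
          (Function.update (Function.update P h (hs.drop (b :: v).length)) c []) := by
      congr 1
      · rw [Function.update_idem, Function.update_self, ← List.append_assoc, ← List.reverse_append,
          List.length_cons, show v.length + 1 = 1 + v.length by omega, List.take_add]
      · rw [Function.update_idem, Function.update_comm hhc, Function.update_idem,
          Function.update_comm hhc.symm, List.drop_drop, List.length_cons, Nat.add_comm]
    cases b
    · exact (Runs.loop_false' hk hupd hbody (hrest.congr e)).of_eq rfl (by simp; omega)
    · exact (Runs.loop_true' hk hupd hbody (hrest.congr e)).of_eq rfl (by simp; omega)

/-- One guarded move of the top bit of the bank register `x` onto `s`. [folklore] -/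
theorem runs_truncStep (xs y z s t u f g : List Bool) (P : Regs κ) :
    Runs (pop (Sum.inl .x : AReg ⊕ κ) (push (Sum.inl .s) true) (push (Sum.inl .s) false) skip)
      (Sum.elim (file xs y z s t u f g) P)
      (Sum.elim (file (xs.drop 1) y z ((xs.take 1).reverse ++ s) t u f g) P) 3 := by
  cases xs with
  | nil => exact (Runs.pop_nil _ _ rfl (Runs.skip _)).of_eq rfl (by norm_num)
  | cons d xs =>
    have hkx : (Sum.elim (file (d :: xs) y z s t u f g) P) (Sum.inl AReg.x) = d :: xs := rfl
    have hup : Function.update (Sum.elim (file (d :: xs) y z s t u f g) P) (Sum.inl AReg.x) xs =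
        Sum.elim (file xs y z s t u f g) P := by rw [Sum.update_elim_inl, update_file_x]
    cases d
    · refine (Runs.pop_false' _ _ hkx hup (Runs.push' ?_)).of_eq rfl (by norm_num)
      rw [Sum.update_elim_inl, update_file_s]; rfl
    · refine (Runs.pop_true' _ _ hkx hup (Runs.push' ?_)).of_eq rfl (by norm_num)
      rw [Sum.update_elim_inl, update_file_s]; rfl

/-- `truncLoop c`: pop the counter register `c` bit by bit, each time moving the top bit of the
bank register `x` onto `s` (nothing if `x` is empty): `s := reverse (take |c| x) ++ s`,
`x := drop |c| x`. [folklore] -/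
def truncLoop (c : κ) : Com (AReg ⊕ κ) :=
  loop (Sum.inr c)
    (pop (Sum.inl .x) (push (Sum.inl .s) true) (push (Sum.inl .s) false) skip)
    (pop (Sum.inl .x) (push (Sum.inl .s) true) (push (Sum.inl .s) false) skip)

/-- **Simulation of `truncLoop`**, in `5|c| + 1` steps. [folklore] -/
theorem runs_truncLoop (c : κ) (v : List Bool) :
    ∀ (xs y z s t u f g : List Bool) (P : Regs κ), P c = v →
      Runs (truncLoop c) (Sum.elim (file xs y z s t u f g) P)
        (Sum.elim (file (xs.drop v.length) y z ((xs.take v.length).reverse ++ s) t u f g)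
          (Function.update P c []))
        (5 * v.length + 1) := by
  induction v with
  | nil =>
    intro xs y z s t u f g P hc
    refine (Runs.loop_nil _ _ (by simpa only [Sum.elim_inr] using hc)).of_eq ?_ (by simp)
    rw [Function.update_eq_self_iff.2 hc.symm]; rfl
  | cons b v ih =>
    intro xs y z s t u f g P hc
    have hk : (Sum.elim (file xs y z s t u f g) P) (Sum.inr c) = b :: v := by
      simpa only [Sum.elim_inr] using hc
    have hupd : Function.update (Sum.elim (file xs y z s t u f g) P) (Sum.inr c) v =
        Sum.elim (file xs y z s t u f g) (Function.update P c v) := by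
      rw [Sum.update_elim_inr]
    have hbody := runs_truncStep xs y z s t u f g (Function.update P c v)
    have hrest := ih (xs.drop 1) y z ((xs.take 1).reverse ++ s) t u f g (Function.update P c v)
      (Function.update_self ..)
    have e : Sum.elim (file ((xs.drop 1).drop v.length) y z
          (((xs.drop 1).take v.length).reverse ++ ((xs.take 1).reverse ++ s)) t u f g)
        (Function.update (Function.update P c v) c []) =
        Sum.elim (file (xs.drop (b :: v).length) y z ((xs.take (b :: v).length).reverse ++ s) t u f g)
          (Function.update P c []) := by
      rw [Function.update_idem, ← List.append_assoc, ← List.reverse_append, List.drop_drop,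
        List.length_cons, show v.length + 1 = 1 + v.length by omega, List.take_add]
    cases b
    · exact (Runs.loop_false' hk hupd hbody (hrest.congr e)).of_eq rfl (by simp; omega)
    · exact (Runs.loop_true' hk hupd hbody (hrest.congr e)).of_eq rfl (by simp; omega)

end BankPlus

end Com

end Literature.Computability.Complexity
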